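import Literature.AnabelianGeometry.EtaleTheta.Discharge.Sec2Def21OfSection
import Literature.AnabelianGeometry.EtaleTheta.SettingModelChiOriginProfile
import HarnessLib

/-!
# `ThetaCovers.TemperedCoverData` from a `MuTwoSetting` C-level record and a SECTION of `Π^tp_X ↠ G_K` (no cusp, no hIx),
# and its instance at the KUMMER-carrying inversion model `χ′`

S. Mochizuki, *The étale theta function and its Frobenioid-theoretic manifestations*, Publ. RIMS **45** (2009) [EtTh], §2,
Def. 2.1 p. 36, Def. 2.3 p. 38, Prop. 2.4 p. 38, Def. 2.5 (i) p. 39 («determined, in effect, by the choice of a splitting of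
`D_x → G_K`») [cite: MochizukiEtTh2009, Def 2.5 (i) p.39]. Cell abc-iut, layer L2, seat abc-iut-L2-t10 (gen 6) — the
`coverDataAx` constructor lineage, row «COVERDATAAX FROM A SECTION» part 3 (R312 junction).

WHY. abc-iut-L2-d3's assembly `CLevelData.temperedCoverData` (gen 5) / `temperedCoverDataOfHuu` (gen 6) extends gen 4's
`PiCData.coverDataAx … hx hIx …`, whose binder hIx is FALSE at every model that carries Kummer data (χ-models: toral cusp); so
no `TemperedCoverData` could be assembled where an `EtaleThetaData` lives. THIS file swaps the base for gen 6's SECTION cover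
`PiCData.coverDataAxOfSection` (p449075 ✓; `Dx :=` the `D̄_x`-preimage of a section) and keeps the rest of the gen-5 assembly
VERBATIM (abc-iut-L2-d3's lemmas BY NAME; Def. 2.1/2.3 re-keyed in `Discharge/Sec2Def21OfSection`):
* §1 **`CLevelData.temperedCoverDataOfSection e ιC hιC hinj op hodd s hsa hsZ hsc hιell hN hY : TemperedCoverData l`** —
  binders = {`op`, a CONTINUOUS section `s : G_K → Π^tp_Y` of `aug`, hιell (P-C4), hN/hY (P-C7 ⟸ L02)}; NO cusp, NO hIx, NO
  external splitting (`Π_{C̲̲} := S·E·⟨ι₀⟩` over the section's own closed splitting); `rfl` bookkeeping;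
* §2 **INSTANCE `temperedCoverDataInvχ' l hodd` at abc-iut-w5-d140's `MuTwoSetting.inversionModelχ′`** (Kummer-carrying, cusped,
  `ε_± = ι`): `s :=` the Galois section `sectionχ'` (`toZ ∘ s = 1`, continuous), hιell = p443309's
  `inv_ell_piCData_inversionModelχ'`, L02 = abc-iut-L6-d6/L2-lineage's `kerToZIsCompactlyGenerated_modelχ` (same `Π^tp_X`), over
  THE completion `toPiCHat`; census headline **`MuTwoSetting.exists_kummerData_cLevelData_temperedCoverData`**: `KummerData`,
  `IsEtThOrigin`, `CLevelData` and a `TemperedCoverData l` with `Π^tp_C = M.GtpC`, `Π^tp_Ÿ = inclX(Π^tp_Ÿ)` JOINTLY AT ONE MODEL —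
  the input side of abc-iut-L2-t2's `OrbitEmbedding C T` (ι := inclX, `map_GtpYdd` by `rfl`) where `E : EtaleThetaData` EXISTS
  (what remains for R312 there: `map_Huu` — abc-iut-L2-d3's OfHuu pinning re-keyed on the section datum —, `normal_top/bot`,
  `τ/τ′`).
HONEST LIMITS: the cusp datum is SYNTHETIC (a section's `D̄_x`-preimage, not the decomposition group of the model's toral point);
semi-synthetic model = consistency evidence for the typed interface ONLY. Class (b) construction file: definitions
`CLevelData.temperedCoverDataOfSection`, `SettingModel.temperedCoverDataInvχ'` (constructors / terms of the FROZEN `TemperedCoverData`;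
no instance, no `Prop` fact, no interface clause touched); nothing of [EtTh] asserted; no side taken on [IUTchIII] Cor. 3.12;
typed ≠ proved; instantiated ≠ endorsed.
-/

noncomputable section

namespace Literature.AnabelianGeometry.EtaleTheta

open Literature.AnabelianGeometry.SemiGraphs ThetaCovers
open _root_.Topology

namespace MuTwoSetting.CLevelData

variable {p : ℕ} [Fact p.Prime] {M : MuTwoSetting p}
variable {PC : Type} [Group PC] [TopologicalSpace PC] [IsTopologicalGroup PC] [T2Space PC]

/-! ## §1. The assembly over the section cover -/

/-- **`TemperedCoverData l` at a `MuTwoSetting` C-level record FROM A SECTION** (Def. 2.1 / 2.3 / Prop. 2.4 data of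
`C = X/±1`): profinite part = gen 6's `PiCData.coverDataAxOfSection` over `I := e.piCDataOf ιC hιC` (cusp datum = the
`D̄_x`-preimage of `s`); `Π_{C̲̲} :=` the open type-`(1, l-torsΘ)±` subgroup of `exists_PiCuu_ofSection'` containing the section's
splitting; tempered part verbatim from abc-iut-L2-d3's gen-5 assembly (`Π^tp_C := M.GtpC`, `toHat := ιC`, `Π^tp_Y := inclX(Ker toZ)`,
`Π^tp_Ÿ := inclX(Π^tp_Ÿ)`, `Π^tp_Ċ := dotC ε_Z`). NO cusp, NO hIx. [cite: MochizukiEtTh2009, Def 2.3 p.38] -/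
def temperedCoverDataOfSection (e : M.CLevelData) (ιC : M.GtpC →ₜ* PC) (hιC : IsProfiniteCompletion ιC)
    (hinj : Function.Injective ιC) (op : M.toThetaSetting.OncePuncturedData) {l : ℕ} (hodd : Odd l)
    (s : ↥M.GK →* M.PiTemp) (hsa : ∀ σ, M.aug (s σ) = (σ : GQp p)) (hsZ : ∀ σ, M.toZ (s σ) = 1) (hsc : Continuous s)
    (hιell : ∀ c ∈ (e.piCDataOf ιC hιC).augGK.ker, c ∉ (e.piCDataOf ιC hιC).PiX →
      ∀ d ∈ (e.piCDataOf ιC hιC).PiX ⊓ (e.piCDataOf ιC hιC).augGK.ker,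
        c * d * c⁻¹ * d ∈ (e.piCDataOf ιC hιC).barTheta l)
    (hN : ((M.GtpXu l).map M.inclX).Normal) (hY : (M.GtpY.map M.inclX).Normal) : TemperedCoverData.{0} l :=
  { (e.piCDataOf ιC hιC).coverDataAxOfSection l op hodd s hsa hιell
      ((e.piCDataOf ιC hιC).inv_theta_of_inv_ell l op hιell) with
    PiCuu := Classical.choose (e.exists_PiCuu_ofSection' ιC hιC op hodd s hsa hιell hsZ hN hsc)
    isTypeLTorsThetaPm := (Classical.choose_spec (e.exists_PiCuu_ofSection' ιC hιC op hodd s hsa hιell hsZ hN hsc)).1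
    isOpen_PiCuu' := (Classical.choose_spec (e.exists_PiCuu_ofSection' ιC hιC op hodd s hsa hιell hsZ hN hsc)).2.1
    Gtp := M.GtpC
    toHat := ιC.toMonoidHom
    continuous_toHat := ιC.continuous
    injective_toHat := hinj
    isProfiniteCompletion_toHat := hιC
    PiYtp := M.GtpY.map M.inclX
    PiYtp_le := map_inclX_GtpY_le ιC hιC _ (e.piCDataOf_incl_toHat ιC hιC)
    PiYtp_normal := hY
    isOpen_PiYtp := e.isOpen_map_inclX_GtpY
    quotZ := by
      haveI := hY
      exact nonempty_quot_map_inclX_GtpY_mulEquiv ιC hιC _ (e.piCDataOf_incl_toHat ιC hιC)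
    PiYddtp := M.GtpYdd.map M.inclX
    PiYddtp_le := map_inclX_GtpYdd_le M
    isOpen_PiYddtp := e.isOpen_map_inclX_GtpYdd
    relIndex_PiYddtp := relIndex_map_inclX_GtpYdd M
    PiCdot := M.dotC (Classical.choose M.exists_isAdmissibleEpsZ)
    index_PiCdot := M.index_dotC (Classical.choose_spec M.exists_isAdmissibleEpsZ)
    isOpen_PiCdot := e.isOpen_dotC _
    PiCdot_ne := dotC_ne_comap_range ιC hιC _ (e.piCDataOf_incl_toHat ιC hιC)
      (Classical.choose_spec M.exists_isAdmissibleEpsZ) }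

section Identities

variable (e : M.CLevelData) (ιC : M.GtpC →ₜ* PC) (hιC : IsProfiniteCompletion ιC)
  (hinj : Function.Injective ιC) (op : M.toThetaSetting.OncePuncturedData) {l : ℕ} (hodd : Odd l)
  (s : ↥M.GK →* M.PiTemp) (hsa : ∀ σ, M.aug (s σ) = (σ : GQp p)) (hsZ : ∀ σ, M.toZ (s σ) = 1) (hsc : Continuous s)
  (hιell : ∀ c ∈ (e.piCDataOf ιC hιC).augGK.ker, c ∉ (e.piCDataOf ιC hιC).PiX →
    ∀ d ∈ (e.piCDataOf ιC hιC).PiX ⊓ (e.piCDataOf ιC hιC).augGK.ker,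
      c * d * c⁻¹ * d ∈ (e.piCDataOf ιC hιC).barTheta l)
  (hN : ((M.GtpXu l).map M.inclX).Normal) (hY : (M.GtpY.map M.inclX).Normal)

/-- Bookkeeping (`rfl`): the underlying `CoverDataAx` is gen 6's `coverDataAxOfSection`; `Π^tp_C`, `toHat`, `Π^tp_Y`, `Π^tp_Ÿ` are
`M.GtpC`, `ιC`, `inclX(Π^tp_Y)`, `inclX(Π^tp_Ÿ)` — the four identities abc-iut-L2-t2's `OrbitEmbedding` reads with `ι := inclX`.
[cite: MochizukiEtTh2009, Prop 2.4 p.38] -/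
theorem temperedCoverDataOfSection_eqs :
    (e.temperedCoverDataOfSection ιC hιC hinj op hodd s hsa hsZ hsc hιell hN hY).toCoverDataAx =
      (e.piCDataOf ιC hιC).coverDataAxOfSection l op hodd s hsa hιell ((e.piCDataOf ιC hιC).inv_theta_of_inv_ell l op hιell) ∧
    (e.temperedCoverDataOfSection ιC hιC hinj op hodd s hsa hsZ hsc hιell hN hY).Gtp = M.GtpC ∧
    (e.temperedCoverDataOfSection ιC hιC hinj op hodd s hsa hsZ hsc hιell hN hY).toHat = ιC.toMonoidHom ∧
    (e.temperedCoverDataOfSection ιC hιC hinj op hodd s hsa hsZ hsc hιell hN hY).PiYtp = M.GtpY.map M.inclX ∧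
    (e.temperedCoverDataOfSection ιC hιC hinj op hodd s hsa hsZ hsc hιell hN hY).PiYddtp = M.GtpYdd.map M.inclX :=
  ⟨rfl, rfl, rfl, rfl, rfl⟩

/-- **`Π_{C̲̲}` of the assembled cover** is open, contains the section's splitting `incl(toHat(s G_K))·Ker`, and is PINNED to
`Π_X̲`: `(Π_{C̲̲} ∩ Π_X)·Δ̄_Θ-preimage = cl(ιC(inclX(Π^tp_X̲)))`. [cite: MochizukiEtTh2009, Def 2.3 p.38] -/
theorem temperedCoverDataOfSection_PiCuu :
    IsOpen ((e.temperedCoverDataOfSection ιC hιC hinj op hodd s hsa hsZ hsc hιell hN hY).PiCuu :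
      Set (e.temperedCoverDataOfSection ιC hιC hinj op hodd s hsa hsZ hsc hιell hN hY).PiC) ∧
    (e.piCDataOf ιC hιC).sectionRange s ⊔ (e.piCDataOf ιC hιC).barKer l ≤
      (e.temperedCoverDataOfSection ιC hιC hinj op hodd s hsa hsZ hsc hιell hN hY).PiCuu ∧
    ((e.temperedCoverDataOfSection ιC hιC hinj op hodd s hsa hsZ hsc hιell hN hY).PiCuu ⊓ (e.piCDataOf ιC hιC).PiX) ⊔
        (e.piCDataOf ιC hιC).barTheta l = (((M.GtpXu l).map M.inclX).map ιC.toMonoidHom).topologicalClosure :=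
  (Classical.choose_spec (e.exists_PiCuu_ofSection' ιC hιC op hodd s hsa hιell hsZ hN hsc)).2

/-- **`Π_X̲` of the assembled cover IS `cl(ιC(inclX(Π^tp_X̲)))`** (`T.PiXu = (Π_{C̲̲} ∩ Π_X)·Δ̄_Θ-preimage`).
[cite: MochizukiEtTh2009, Def 2.1 p.36] -/
theorem temperedCoverDataOfSection_PiXu :
    (e.temperedCoverDataOfSection ιC hιC hinj op hodd s hsa hsZ hsc hιell hN hY).PiXu =
      (((M.GtpXu l).map M.inclX).map ιC.toMonoidHom).topologicalClosure :=
  (e.temperedCoverDataOfSection_PiCuu ιC hιC hinj op hodd s hsa hsZ hsc hιell hN hY).2.2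

/-- **`Π^tp_X̲` of the assembled cover IS `inclX(Π^tp_X̲)`** (pull-back of the closure of an open finite-index subgroup,
abc-iut-L2-d3's `comap_closure_map_inclX`). [cite: MochizukiEtTh2009, Prop 2.4 p.38] -/
theorem temperedCoverDataOfSection_tp_PiXu :
    (e.temperedCoverDataOfSection ιC hιC hinj op hodd s hsa hsZ hsc hιell hN hY).tp
        (e.temperedCoverDataOfSection ιC hιC hinj op hodd s hsa hsZ hsc hιell hN hY).PiXu = (M.GtpXu l).map M.inclX := by
  haveI : NeZero l := ⟨by obtain ⟨k, hk⟩ := hodd; omega⟩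
  haveI : (M.GtpXu l).FiniteIndex := ⟨by rw [M.index_GtpXu l]; exact NeZero.ne l⟩
  rw [TemperedCoverData.tp, temperedCoverDataOfSection_PiXu]
  exact e.comap_closure_map_inclX ιC hιC _ (M.isOpen_GtpXu l)

/-- **Def. 2.5 (i)(a) HOLDS for the assembled cover**: `Π^tp_Y ≤ Π^tp_X̲`. [cite: MochizukiEtTh2009, Def 2.5 (i) p.39] -/
theorem temperedCoverDataOfSection_PiYtp_le_tp_PiXu :
    (e.temperedCoverDataOfSection ιC hιC hinj op hodd s hsa hsZ hsc hιell hN hY).PiYtp ≤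
      (e.temperedCoverDataOfSection ιC hιC hinj op hodd s hsa hsZ hsc hιell hN hY).tp
        (e.temperedCoverDataOfSection ιC hιC hinj op hodd s hsa hsZ hsc hιell hN hY).PiXu := by
  rw [temperedCoverDataOfSection_tp_PiXu]
  exact Subgroup.map_mono (M.GtpY_le_GtpXu l)

/-- The composite augmentation `Π^tp_X → Π^tp_C → Π_C → G_K` of the assembled cover is the §1 augmentation (abc-iut-L2-t2's
`OrbitEmbedding.aug_ι` with `gk := MulEquiv.refl`). [cite: MochizukiEtTh2009, Def 2.1 p.36] -/
theorem temperedCoverDataOfSection_aug_toHat_inclX (z : M.PiTemp) :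
    (e.temperedCoverDataOfSection ιC hιC hinj op hodd s hsa hsZ hsc hιell hN hY).aug
        ((e.temperedCoverDataOfSection ιC hιC hinj op hodd s hsa hsZ hsc hιell hN hY).toHat (M.inclX z)) =
      (MulEquiv.refl ↥M.GK) ⟨M.aug z, M.aug_mem_GK z⟩ := by
  apply Subtype.ext
  show (((e.piCDataOf ιC hιC).augGK (ιC (M.inclX z)) : M.GK) : GQp p) = M.aug z
  rw [ThetaSetting.PiCData.coe_augGK_apply, e.piCDataOf_aug_apply, e.augC_inclX]

end Identities

end MuTwoSetting.CLevelData

/-! ## §2. Instance at the Kummer-carrying cusped inversion model `χ′` -/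

namespace SettingModel

open Literature.AnabelianGeometry.SemiGraphs ThetaCovers
open _root_.Topology

variable (p : ℕ) [Fact p.Prime]

/-- L02 «`Π^tp_Y` is topologically generated by compact subgroups» at `modelχ′` (same `Π^tp_X`, same `toZ` as `modelχ`:
abc-iut-L2-lineage's `kerToZIsCompactlyGenerated_modelχ`, re-typed). [cite: MochizukiEtTh2009, §1 p.12] -/
theorem kerToZIsCompactlyGenerated_modelχ' : Thm16Sub.KerToZIsCompactlyGenerated (ThetaSetting.modelχ' p) :=
  kerToZIsCompactlyGenerated_modelχ p

/-- **`TemperedCoverData l` at `MuTwoSetting.inversionModelχ′` with NO binder** (odd `l`): the section assembly over THE completion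
`toPiCHat` of the tempered `Π^tp_C = Π^tp_X ⋊_ι ℤ/2`, with the Galois section, hιell = abc-iut-w5-d140's
`inv_ell_piCData_inversionModelχ'`, the once-punctured parameters of `modelχ′` and L02 at `modelχ′`. DEFINED.
[cite: MochizukiEtTh2009, Def 2.3 p.38] -/
def temperedCoverDataInvχ' (l : ℕ) (hodd : Odd l) : TemperedCoverData.{0} l :=
  let eX := (nonempty_oncePuncturedData_modelχ' p).some
  (cLevelDataInvχ' p).temperedCoverDataOfSection (cLevelDataInvχ' p).toPiCHat (cLevelDataInvχ' p).isProfiniteCompletion_toPiCHat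
    (cLevelDataInvχ' p).toPiCHat_injective eX hodd (sectionχ' p) (aug_sectionχ' p) (toZ_sectionχ' p) (continuous_sectionχ' p)
    (inv_ell_piCData_inversionModelχ' p l eX)
    ((cLevelDataInvχ' p).map_inclX_GtpXu_normal l (kerToZIsCompactlyGenerated_modelχ' p))
    ((cLevelDataInvχ' p).map_inclX_GtpY_normal (kerToZIsCompactlyGenerated_modelχ' p))

/-- Bookkeeping (`rfl`): `Π^tp_C`, `toHat`, `Π^tp_Ÿ` of `temperedCoverDataInvχ′` are the model's `Π^tp_C`, its completion map
and `inclX(Π^tp_Ÿ)`. [cite: MochizukiEtTh2009, Prop 2.4 p.38] -/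
theorem temperedCoverDataInvχ'_eqs (l : ℕ) (hodd : Odd l) :
    (temperedCoverDataInvχ' p l hodd).Gtp = (MuTwoSetting.inversionModelχ' p).GtpC ∧
    (temperedCoverDataInvχ' p l hodd).toHat = (cLevelDataInvχ' p).toPiCHat.toMonoidHom ∧
    (temperedCoverDataInvχ' p l hodd).PiYddtp =
      (MuTwoSetting.inversionModelχ' p).GtpYdd.map (MuTwoSetting.inversionModelχ' p).inclX :=
  ⟨rfl, rfl, rfl⟩

/-- **CENSUS HEADLINE.** `KummerData` (abc-iut-w5-d171), `IsEtThOrigin`, `CLevelData` (abc-iut-w5-d140) and a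
`ThetaCovers.TemperedCoverData l` whose tempered group IS `Π^tp_C` of the model and whose `Π^tp_Ÿ` IS `inclX(Π^tp_Ÿ)` are JOINTLY
available at ONE model — the cusped inversion model over the χ-twisted root — for every odd `l`: the INPUT side of an
`OrbitEmbedding C T` (ι := `inclX`) at a model where `EtaleThetaData` exists. [cite: MochizukiEtTh2009, Def 2.5 (i) p.39] -/
theorem _root_.Literature.AnabelianGeometry.EtaleTheta.MuTwoSetting.exists_kummerData_cLevelData_temperedCoverData
    (l : ℕ) (hodd : Odd l) :
    ∃ (M : MuTwoSetting p) (_ : M.CLevelData) (T : TemperedCoverData.{0} l),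
      Nonempty M.toThetaSetting.KummerData ∧ M.toThetaSetting.IsEtThOrigin ∧
      T.Gtp = M.GtpC ∧ (∃ x : M.Pt, M.IsCusp x) := by
  exact ⟨MuTwoSetting.inversionModelχ' p, cLevelDataInvχ' p, temperedCoverDataInvχ' p l hodd, nonempty_kummerData_modelχ' p,
    MuTwoSetting.inversionModelχ'_isEtThOrigin p, rfl, MuTwoSetting.exists_isCusp_inversionModelχ' p⟩

end SettingModel

end Literature.AnabelianGeometry.EtaleTheta

end
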